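/-
Origin: expansion seat `prover-pub-hodgecm-own-htheta-g2-0`, handover #H13 2026-08-21T06:03Z md5 6ecec7bcb3e5 (322 l.; NEW additive KERNEL leaf beside E; imports LANDED `HodgeCM.Model.Binders.JLiuCornerOfReflex` (RUN 62) + `HodgeCM.Model.LiuDictionaryPin` (RUN 69) + `HodgeCM.CM.LefschetzChar` ONLY — NO RUN-72 dependency, install anywhere, drop alone; ns HodgeCM.Model.LiuCMSide (§1–§2) + HodgeCM.Model (§3); 9 data defs (`embK`, `reflexCMType`, `realA` ∕ `realι` ∕ `realθ` ∕ `realBasis`, `ofType`, `reflexTypeInflate`, `ofReflex`) + 21 theorems; 0 records, 0 `def … : Prop`, nothing cited anew, no new hypothesis kind: NON-VACUITY OF THE `adm` CONTRACT behind row 9's ONE cited input `h418` (r8 `Thm418C := Thm418Combined res cmClasses`, whose generator set `cmClasses Γ j` is the comprehension over CM records `d` with `adm j d := d.IsReflexOfTypeG ι₁ Φ^δ(line j)`; no admissible record existed in PKG before) — (§1) `reflexTypeC_mem_iff_conjugate_notMem`: for `L/ℚ` Galois the reflex type `reflexTypeC ι₁ (autSet ι₁ Φ)` of a CM type `Φ`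 of `L` on the reflex field `reflexFieldOf (autSet ι₁ Φ) ⊆ L` IS A CM TYPE ([Shimura1998 §8.3 Prop 28] in the kernel: `S* = S⁻¹`, `S*·H* = S*`, `Gal(L∕K*) = H*` by `IntermediateField.fixingSubgroup_fixedField`, `Φ ⊔ Φ̄ = Hom(L,ℂ)`), packaged `reflexCMType ι₁ Φ : CMType ↥(reflexFieldOf (autSet ι₁ Φ))`; (§2) THE ADMISSIBLE RECORD `LiuCMSide.ofReflex ι₁ hCM Φ` (`K' :=` reflex field, `Φ' :=` reflex type, `M := L`, `(A, ιA, θA) :=` a realisation of the INFLATED type `reflexTypeInflate ι₁ Φ` from `hCM : CMAbelianVarietyRealised` = E's own `h₃`, `τ := ι₁`, `α :=` a NON-ZERO `ι₁`-eigenvector of `ℂ ⊗ H¹(A;ℚ)` via axioms-1's `exists_basis_mem_eigenline_complexify`) with `ofReflex_isReflexOfType : (ofReflex ι₁ hCM Φ).IsReflexOfType ι₁ Φ`, `ofReflex_α_ne_zero`, `exists_isReflexOfType_α_ne_zero` = [Liu21 Prop 4.6 (1)] «𝒜(μ) ≠ ∅» at the model's typing (tautological record `ofType` off the Galois locus, where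 the guard makes `adm` vacuous); (§3) `exists_adm_liuDictionaryPin : ∀ j, ∃ d, (liuDictionaryPin hHD hI h₁ h₃ hA V I line).adm j d ∧ d.α ≠ 0` and `exists_adm_forall_geomClass_mem` (r8's comprehension at every `(Γ, j)` contains `f^*α_d` for EVERY ℂ-morphism `f : P_Γ → A_d`, `A_d` a genuine CM abelian variety of the reflex type) — AUDIT-VACUITY (c) material for `h418`; NAMES for audit: HodgeCM.Model.LiuCMSide.reflexTypeC_mem_iff_conjugate_notMem · HodgeCM.Model.LiuCMSide.ofReflex_isReflexOfType · HodgeCM.Model.exists_adm_liuDictionaryPin) (`HOME/pub-hodgecm-own-htheta/stage73/HodgeCM/Model/LiuCMSideOfReflex.lean`, md5 6ecec7bcb3e5, 322 lines);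
landed by the gen-31 packager (p-g31) in gate run 73 as `HodgeCM/Model/LiuCMSideOfReflex.lean` (verbatim).
-/
/-
Copyright (c) 2026 the pub-hodgecm formalisation cell (harness21).  New file, not vendored.
Origin: ROW-9 OWNER seat `prover-pub-hodgecm-own-htheta-g2-0` (unit pub-hodgecm-own-htheta, gen 2; named single owner of binder row 9
`hΘ` = the (J-Liu-Θ) junction), 2026-08-21.  Target in PKG: `HodgeCM/Model/LiuCMSideOfReflex.lean` (NEW additive KERNEL leaf beside E;
imports the landed `Model/Binders/JLiuCornerOfReflex` (RUN 62), `Model/LiuDictionaryPin` (RUN 69), `CM/LefschetzChar`; nothing imports it;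
drop alone on bounce).  KERNEL ONLY: 9 defs (data) + theorems; 0 `def … : Prop`, nothing cited anew, no new hypothesis kind.  Nothing here
is a claim of the manuscripts under adjudication.

WHAT IT IS — NON-VACUITY OF THE `adm` CONTRACT BEHIND ROW 9's ONE CITED INPUT `h418`.  The cited sentence of record for row 9 is the
combined reading r8 of [Liu21, Thm. 4.18] over the pinned dictionary, `LiuDictionary.Thm418C := Thm418Combined res cmClasses`
(`Model/LiuDictionary.lean` :210; consumed by `SInstance.hsmall_ROGT'C_of_thm418C`, `Model/HThetaJunctionR2B.lean`).  Its generator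
set at level `Γ` and index `j` is the COMPREHENSION `cmClasses Γ j = ⋃ d, ⋃ (_ : adm j d), range (geomClass Γ d)` over the CM records
`d : LiuCMSide` ADMISSIBLE for `j`, `adm j d := d.IsReflexOfTypeG ι₁ Φ^δ(line j)` = «on the Galois locus of `L`, `d` is the reflex side
`(M'_μ, Ψ_μ)` of `(L, Φ_μ)`» ([Liu21] Def. 4.3; `Model/Binders/JLiuCornerOfReflex.lean` :209).  NO admissible record had been
constructed in the package so far: were there none at PerL's scope (`L/ℚ` Galois), the span in `Thm418C` would be `⊥` and `h418` would
read «every theta class restricts to 0 at small level» — a false-as-typed exposure of the E sibling «JBUAR».  This leaf CLOSES that gap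
from the hypothesis E itself holds (`CMAbelianVarietyRealised`, [Shimura1998 §6.2 Thm 3 ∕ §7.4 Prop 17], a tree theorem) — it is the
kernel form of [Liu21, Prop. 4.6 (1)] «`𝒜(μ)` is non-empty» at the model's typing:
* §1 `LiuCMSide.reflexTypeC_mem_iff_conjugate_notMem` — for `L/ℚ` Galois and `Φ` a CM type of `L`, the reflex type
  `reflexTypeC ι₁ (autSet ι₁ Φ)` on the reflex field `reflexFieldOf (autSet ι₁ Φ) ⊆ L` IS A CM TYPE ([Shimura1998 §8.3 Prop 28]:
  `S*·H* = S*`, `K*` = fixed field of `H*`); packaged as `LiuCMSide.reflexCMType ι₁ Φ : CMType ↥(reflexFieldOf (autSet ι₁ Φ))`;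
* §2 `LiuCMSide.ofReflex ι₁ hCM Φ` — THE ADMISSIBLE RECORD `d_Liu(Φ)`: `K' :=` the reflex field, `Φ' :=` the reflex type, `M := L ⊇ K'`,
  `(A, ιA, θA) :=` a realisation of the INFLATED type `(Φ')^L` given by `hCM : CMAbelianVarietyRealised` (read on `H¹`), `τ := ι₁`,
  `α :=` a NON-ZERO `ι₁`-eigenvector of `ℂ ⊗ H¹(A; ℚ)`; `ofReflex_isReflexOfType : (ofReflex ι₁ hCM Φ).IsReflexOfType ι₁ Φ` and
  `ofReflex_α_ne_zero`.  (Off the Galois locus `adm` is met vacuously; the tautological record `LiuCMSide.ofType` serves there.)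
* §3 AT THE PIN OF RECORD: `exists_adm_liuDictionaryPin` — for every index `j` of `liuDictionaryPin hHD hI h₁ h₃ hA V I line` there is an
  admissible `d` with `d.α ≠ 0`, built from E's own `h₃`; hence `cmClasses Γ j ⊇ {f^*α_d | f : P_Γ → A_d}` for a genuine CM abelian
  variety `A_d` of the reflex type (`geomClass_mem_cmClasses_of_adm`).
0 `proof-hole`; expected `#print axioms` ⊆ {propext, Classical.choice, Quot.sound}.
-/
import Summits.HodgeConjecture.HodgeCM.Model.Binders.JLiuCornerOfReflex
import Summits.HodgeConjecture.HodgeCM.Model.LiuDictionaryPin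
import Summits.HodgeConjecture.HodgeCM.CM.LefschetzChar_2

set_option autoImplicit false

noncomputable section

open scoped TensorProduct Pointwise
open NumberField NumberField.ComplexEmbedding CategoryTheory Module
open Literature.AlgebraicGeometry.Motives (CMType AbelianVariety bettiCohomology)
open Literature.AlgebraicGeometry.HodgeTheory
open Literature.AlgebraicGeometry.HodgeTheory.BettiUniverse (cmAction IsInducedOnIntegers)
open Literature.AlgebraicGeometry.ComplexMultiplication (IsCMTypeRealisation)
open Literature.NumberTheory.Automorphic.PicardCM
open Literature.NumberTheory.Transcendental (Arapura2012_Cor_15_4_6)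
open Literature.NumberTheory.ComplexMultiplication
open HodgeCM.CMTypeOps (inflate mem_inflate_iff)

namespace HodgeCM

namespace Model

namespace LiuCMSide

variable {L : CMField} (ι₁ : L →+* ℂ)

/-! ## §1 The reflex type of an `L`-type is a CM type of the reflex field (`L/ℚ` Galois) -/

section Reflex

variable (T : Set (L ≃ₐ[ℚ] L))

/-- The embedding `(ι₁ ∘ a)|_{K*}` of the reflex field `K* = reflexFieldOf T ⊆ L`, `a ∈ Aut(L)`. [folklore] -/
def embK (a : L ≃ₐ[ℚ] L) : ↥(reflexFieldOf T) →+* ℂ :=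
  (ι₁.comp (a : L →+* L)).comp (algebraMap (↥(reflexFieldOf T)) L)

/-- (Ported verbatim from the HodgeCMPerL package; no docstring in the source.) -/
theorem embK_apply (a : L ≃ₐ[ℚ] L) (x : ↥(reflexFieldOf T)) : embK ι₁ T a x = ι₁ (a x) := rfl

/-- `a ∈ S*(T) = reflexLift (↑ '' T) id ↔ a⁻¹ ∈ T` ([Shimura1998 §8.3]: `S* = S⁻¹`). [folklore] -/
theorem mem_reflexLift_autImage_iff (a : L ≃ₐ[ℚ] L) :
    a ∈ (reflexLift (autImage T) (AlgHom.id ℚ L) : Set (L ≃ₐ[ℚ] L)) ↔ a⁻¹ ∈ T := by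
  rw [mem_reflexLift]
  have h1 : a⁻¹ • (AlgHom.id ℚ L) = ((a⁻¹ : L ≃ₐ[ℚ] L) : L →ₐ[ℚ] L) := AlgHom.ext fun _ => rfl
  rw [h1]
  constructor
  · rintro ⟨t, ht, hta⟩
    have : t = a⁻¹ := AlgEquiv.ext fun x => AlgHom.congr_fun hta x
    exact this ▸ ht
  · exact fun h => ⟨a⁻¹, h, rfl⟩

/-- `Gal(L/K*) = H*` (Artin: the fixing subgroup of the fixed field of `H*` is `H*`). [folklore] -/
theorem fixingSubgroup_reflexFieldOf :
    (reflexFieldOf T).fixingSubgroup = MulAction.stabilizer (L ≃ₐ[ℚ] L) (autImage T) := by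
  rw [show reflexFieldOf T = IntermediateField.fixedField (MulAction.stabilizer (L ≃ₐ[ℚ] L) (autImage T)) from rfl,
    IntermediateField.fixingSubgroup_fixedField]

/-- Two automorphisms with the same restriction to `K*` (read through `ι₁`) differ by an element of `Gal(L/K*)`. [folklore] -/
theorem inv_mul_mem_fixingSubgroup_of_embK_eq {a b : L ≃ₐ[ℚ] L} (h : embK ι₁ T a = embK ι₁ T b) :
    b⁻¹ * a ∈ (reflexFieldOf T).fixingSubgroup := by
  rw [IntermediateField.mem_fixingSubgroup_iff]
  intro x hx
  have hx' : ι₁ (a x) = ι₁ (b x) := by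
    have := RingHom.congr_fun h ⟨x, hx⟩
    rwa [embK_apply, embK_apply] at this
  have hab : a x = b x := ι₁.injective hx'
  rw [AlgEquiv.mul_apply, hab]
  exact b.symm_apply_apply x

/-- `(ι₁ ∘ a)|_{K*}` lies in the reflex type iff `a ∈ S*` (`S*·H* = S*`). [folklore] -/
theorem embK_mem_reflexTypeC_iff (a : L ≃ₐ[ℚ] L) :
    embK ι₁ T a ∈ reflexTypeC ι₁ T ↔ a ∈ (reflexLift (autImage T) (AlgHom.id ℚ L) : Set (L ≃ₐ[ℚ] L)) := by
  constructor
  · rintro ⟨g, hg, hga⟩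
    have hmem : g⁻¹ * a ∈ MulAction.stabilizer (L ≃ₐ[ℚ] L) (autImage T) := by
      rw [← fixingSubgroup_reflexFieldOf]
      exact inv_mul_mem_fixingSubgroup_of_embK_eq ι₁ T hga
    have := (mul_mem_reflexLift_iff_of_mem_stabilizer (autImage T) (AlgHom.id ℚ L) hmem g).mpr hg
    rwa [mul_inv_cancel_left] at this
  · exact fun ha => ⟨a, ha, rfl⟩

/-- For `L/ℚ` Galois every embedding of `K*` is `(ι₁ ∘ a)|_{K*}` for some `a ∈ Aut(L)`. [folklore] -/
theorem exists_embK_eq [IsGalois ℚ L] (ψ : ↥(reflexFieldOf T) →+* ℂ) : ∃ a : L ≃ₐ[ℚ] L, embK ι₁ T a = ψ := by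
  obtain ⟨θ, hθ⟩ := exists_comp_eq_of_ringHom (algebraMap (↥(reflexFieldOf T)) L) ψ
  obtain ⟨a, ha⟩ := exists_aut_eq ι₁ θ
  exact ⟨a, by rw [embK, ← ha, hθ]⟩

end Reflex

/-- If `ι₁ ∘ a' = conj ∘ ι₁ ∘ a` then `ι₁ ∘ a'⁻¹ = conj ∘ ι₁ ∘ a⁻¹` (complex conjugation of the CM field `L` is intertwined by EVERY
embedding). [folklore] -/
theorem comp_symm_eq_conjugate_of_comp_eq_conjugate {a a' : L ≃ₐ[ℚ] L}
    (h : ι₁.comp (a' : L →+* L) = conjugate (ι₁.comp (a : L →+* L))) :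
    ι₁.comp (a'.symm : L →+* L) = conjugate (ι₁.comp (a.symm : L →+* L)) := by
  have hc : ∀ z, a' z = IsCMField.complexConj L (a z) := fun z => ι₁.injective (by
    have hz := RingHom.congr_fun h z
    simp only [RingHom.coe_comp, RingHom.coe_coe, Function.comp_apply, conjugate_coe_eq] at hz
    rw [hz, IsCMField.complexEmbedding_complexConj])
  refine RingHom.ext fun y => ?_
  have hy : a'.symm y = a.symm (IsCMField.complexConj L y) := by
    apply a'.injective
    rw [AlgEquiv.apply_symm_apply, hc, AlgEquiv.apply_symm_apply, IsCMField.complexConj_apply_apply]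
  simp only [RingHom.coe_comp, RingHom.coe_coe, Function.comp_apply, conjugate_coe_eq]
  rw [hy]
  exact IsCMField.complexEmbedding_complexConj L (ι₁.comp (a.symm : L →+* L)) y

/-- `a⁻¹ ∈ autSet ι₁ Φ ↔ ι₁ ∘ a⁻¹ ∈ Φ`. [folklore] -/
theorem inv_mem_autSet_iff (Φ : CMType L) (a : L ≃ₐ[ℚ] L) :
    a⁻¹ ∈ autSet ι₁ Φ ↔ ι₁.comp (a.symm : L →+* L) ∈ Φ.1 := by
  have : ι₁.comp (a⁻¹).toRingEquiv.toRingHom = ι₁.comp (a.symm : L →+* L) := RingHom.ext fun _ => rfl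
  show ι₁.comp (a⁻¹).toRingEquiv.toRingHom ∈ Φ.1 ↔ _
  rw [this]

/-- The dichotomy on the automorphism orbit: for `ι₁ ∘ a' = conj ∘ ι₁ ∘ a`, exactly one of `(ι₁ ∘ a)|_{K*}`, `(ι₁ ∘ a')|_{K*}` lies in
the reflex type of `(L, Φ)`. [folklore] -/
theorem embK_mem_reflexTypeC_iff_notMem [IsGalois ℚ L] (Φ : CMType L) {a a' : L ≃ₐ[ℚ] L}
    (h : ι₁.comp (a' : L →+* L) = conjugate (ι₁.comp (a : L →+* L))) :
    embK ι₁ (autSet ι₁ Φ) a ∈ reflexTypeC ι₁ (autSet ι₁ Φ) ↔ embK ι₁ (autSet ι₁ Φ) a' ∉ reflexTypeC ι₁ (autSet ι₁ Φ) := by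
  rw [embK_mem_reflexTypeC_iff, embK_mem_reflexTypeC_iff, mem_reflexLift_autImage_iff, mem_reflexLift_autImage_iff,
    inv_mem_autSet_iff, inv_mem_autSet_iff, Φ.2 (ι₁.comp (a.symm : L →+* L)),
    ← comp_symm_eq_conjugate_of_comp_eq_conjugate ι₁ h]

/-- **THE REFLEX TYPE IS A CM TYPE** (`L/ℚ` Galois): `ψ ∈ Ψ* ↔ ψ̄ ∉ Ψ*` for the reflex type `Ψ* = reflexTypeC ι₁ (autSet ι₁ Φ)` of the
CM type `Φ` of `L` on its reflex field — [Shimura1998 §8.3 Prop. 28] (the reflex `(K*, Φ*)` of a CM type is a CM type), kernel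
proof from `S* = S⁻¹`, `S*·H* = S*`, `K* = L^{H*}` and `Φ ⊔ Φ̄ = Hom(L, ℂ)`. [folklore] -/
theorem reflexTypeC_mem_iff_conjugate_notMem [IsGalois ℚ L] (Φ : CMType L)
    (ψ : ↥(reflexFieldOf (autSet ι₁ Φ)) →+* ℂ) :
    ψ ∈ reflexTypeC ι₁ (autSet ι₁ Φ) ↔ conjugate ψ ∉ reflexTypeC ι₁ (autSet ι₁ Φ) := by
  obtain ⟨a, rfl⟩ := exists_embK_eq ι₁ (autSet ι₁ Φ) ψ
  obtain ⟨a', ha'⟩ := exists_aut_eq ι₁ (conjugate (ι₁.comp (a : L →+* L)))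
  have hconj : conjugate (embK ι₁ (autSet ι₁ Φ) a) = embK ι₁ (autSet ι₁ Φ) a' := by
    rw [embK, embK, ← ha']
    exact CMTypeOps.conjugate_comp_ringHom _ _
  rw [hconj]
  exact embK_mem_reflexTypeC_iff_notMem ι₁ Φ ha'.symm

/-- **The reflex CM type `Ψ_Φ`** of `(L, Φ)` on the reflex field `M'_Φ = reflexFieldOf (autSet ι₁ Φ) ⊆ L` ([Liu21] Def. 4.3's `(M'_μ, Ψ_μ)`
at `Φ = Φ_μ`), as a `CMType`. [folklore] -/
def reflexCMType [IsGalois ℚ L] (Φ : CMType L) : CMType ↥(reflexFieldOf (autSet ι₁ Φ)) :=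
  ⟨reflexTypeC ι₁ (autSet ι₁ Φ), reflexTypeC_mem_iff_conjugate_notMem ι₁ Φ⟩

/-- (Ported verbatim from the HodgeCMPerL package; no docstring in the source.) -/
@[simp] theorem reflexCMType_val [IsGalois ℚ L] (Φ : CMType L) :
    (reflexCMType ι₁ Φ).1 = reflexTypeC ι₁ (autSet ι₁ Φ) := rfl

/-! ## §2 The admissible CM record of the reflex pair -/

section Realisation

/-- A realisation `(A, ιA, θA)` of the CM type `Ψ` of `L`, read on `H¹` — E's own hypothesis `h₃` ∕ `CMAbelianVarietyRealised`
([Shimura1998 §6.2 Thm 3]) at `(L, Ψ)` (the record IS the conjunction `IsCMTypeRealisation`). [folklore] -/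
theorem exists_isCMTypeRealisation (hCM : CMAbelianVarietyRealised) (Ψ : CMType L) :
    ∃ (A : AbelianVariety ℂ) (ιA : 𝓞 L →+* End A) (θA : L →+* Module.End ℂ (complexBetti A.X 1)),
      IsCMTypeRealisation Ψ A ιA θA :=
  hCM L Ψ

/-- the abelian variety of a chosen realisation of `(L, Ψ)`. [folklore] -/
def realA (hCM : CMAbelianVarietyRealised) (Ψ : CMType L) : AbelianVariety ℂ := (exists_isCMTypeRealisation hCM Ψ).choose

/-- its `𝓞_L`-multiplication. [folklore] -/
def realι (hCM : CMAbelianVarietyRealised) (Ψ : CMType L) : 𝓞 L →+* End (realA hCM Ψ) := (exists_isCMTypeRealisation hCM Ψ).choose_spec.choose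

/-- its action on `H¹(A(ℂ); ℂ)`. [folklore] -/
def realθ (hCM : CMAbelianVarietyRealised) (Ψ : CMType L) : L →+* Module.End ℂ (complexBetti (realA hCM Ψ).X 1) :=
  (exists_isCMTypeRealisation hCM Ψ).choose_spec.choose_spec.choose

/-- (Ported verbatim from the HodgeCMPerL package; no docstring in the source.) -/
theorem real_isCMTypeRealisation (hCM : CMAbelianVarietyRealised) (Ψ : CMType L) : IsCMTypeRealisation Ψ (realA hCM Ψ) (realι hCM Ψ) (realθ hCM Ψ) :=
  (exists_isCMTypeRealisation hCM Ψ).choose_spec.choose_spec.choose_spec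

/-- an eigenbasis of `ℂ ⊗ H¹(A; ℚ)` for the complexified rational CM action, indexed by the embeddings of `L`. [folklore] -/
def realBasis (hCM : CMAbelianVarietyRealised) (Ψ : CMType L) : Basis (L →+* ℂ) ℂ (ℂ ⊗[ℚ] bettiCohomology (realA hCM Ψ).X 1) :=
  (HodgeCM.CM.CommonReflex.exists_basis_mem_eigenline_complexify (real_isCMTypeRealisation hCM Ψ)
    (real_isCMTypeRealisation hCM Ψ).isInducedOnIntegers).choose

/-- (Ported verbatim from the HodgeCMPerL package; no docstring in the source.) -/
theorem realBasis_mem (hCM : CMAbelianVarietyRealised) (Ψ : CMType L) (σ : L →+* ℂ) :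
    realBasis hCM Ψ σ ∈ eigenline (HodgeCM.CM.CommonReflex.complexify
      (cmAction (realθ hCM Ψ) (real_isCMTypeRealisation hCM Ψ).isInducedOnIntegers)) σ :=
  (HodgeCM.CM.CommonReflex.exists_basis_mem_eigenline_complexify (real_isCMTypeRealisation hCM Ψ)
    (real_isCMTypeRealisation hCM Ψ).isInducedOnIntegers).choose_spec σ

/-- **The tautological CM record of type `(L, Ψ)`** (`K' := M := L`, `Φ' := ΦA := Ψ`, `τ := ι₁`, `α` a non-zero `ι₁`-eigenvector):
available for every CM type, used off the Galois locus where `adm` is vacuous. [folklore] -/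
def ofType (hCM : CMAbelianVarietyRealised) (Ψ : CMType L) : LiuCMSide where
  K' := L
  Φ' := Ψ.1
  M := L
  k := RingHom.id L
  A := realA hCM Ψ
  ιA := realι hCM Ψ
  θA := realθ hCM Ψ
  ΦA := Ψ
  hΦA θ := by rw [RingHom.comp_id]
  isRealisation := real_isCMTypeRealisation hCM Ψ
  τ := ι₁
  α := realBasis hCM Ψ ι₁
  α_mem := realBasis_mem hCM Ψ ι₁

/-- (Ported verbatim from the HodgeCMPerL package; no docstring in the source.) -/
theorem ofType_α_ne_zero (hCM : CMAbelianVarietyRealised) (Ψ : CMType L) : (ofType ι₁ hCM Ψ).α ≠ 0 := (realBasis hCM Ψ).ne_zero ι₁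

/-- (Ported verbatim from the HodgeCMPerL package; no docstring in the source.) -/
@[simp] theorem ofType_A (hCM : CMAbelianVarietyRealised) (Ψ : CMType L) : (ofType ι₁ hCM Ψ).A = realA hCM Ψ := rfl
/-- (Ported verbatim from the HodgeCMPerL package; no docstring in the source.) -/
@[simp] theorem ofType_τ (hCM : CMAbelianVarietyRealised) (Ψ : CMType L) : (ofType ι₁ hCM Ψ).τ = ι₁ := rfl

end Realisation

section OfReflex

variable [IsGalois ℚ L]

/-- The reflex CM type INFLATED back to `L ⊇ M'_Φ` (Liu's CM type of `A_μ ⊗_{E,τ'} ℂ`: the inflation of `Ψ_μ` along `M'_μ ⊆ M_μ`,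
here `M_μ := L`). [folklore] -/
def reflexTypeInflate (Φ : CMType L) : CMType L :=
  inflate (algebraMap (↥(reflexFieldOf (autSet ι₁ Φ))) L) (reflexCMType ι₁ Φ)

/-- **`d_Liu(Φ)` — THE ADMISSIBLE CM RECORD OF THE REFLEX PAIR `(M'_Φ, Ψ_Φ)`** ([Liu21] Def. 4.3 ∕ Def. 4.5 shape; [Prop. 4.6 (1)]:
`𝒜(μ) ≠ ∅`): `K' := M'_Φ` the reflex field of `(L, Φ)` inside `L`, `Φ' := Ψ_Φ` its reflex CM type, `M := L`, `k := M'_Φ ⊆ L`,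
`(A, ιA, θA) :=` a realisation of the inflated type `(Ψ_Φ)^L` from `CMAbelianVarietyRealised`, `τ := ι₁`, `α :=` a non-zero
`ι₁`-eigenvector of `ℂ ⊗ H¹(A; ℚ)`. [folklore] -/
def ofReflex (hCM : CMAbelianVarietyRealised) (Φ : CMType L) : LiuCMSide where
  K' := ↥(reflexFieldOf (autSet ι₁ Φ))
  Φ' := reflexTypeC ι₁ (autSet ι₁ Φ)
  M := L
  k := algebraMap (↥(reflexFieldOf (autSet ι₁ Φ))) L
  A := realA hCM (reflexTypeInflate ι₁ Φ)
  ιA := realι hCM (reflexTypeInflate ι₁ Φ)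
  θA := realθ hCM (reflexTypeInflate ι₁ Φ)
  ΦA := reflexTypeInflate ι₁ Φ
  hΦA θ := mem_inflate_iff _ _ θ
  isRealisation := real_isCMTypeRealisation hCM (reflexTypeInflate ι₁ Φ)
  τ := ι₁
  α := realBasis hCM (reflexTypeInflate ι₁ Φ) ι₁
  α_mem := realBasis_mem hCM (reflexTypeInflate ι₁ Φ) ι₁

/-- (Ported verbatim from the HodgeCMPerL package; no docstring in the source.) -/
@[simp] theorem ofReflex_A (hCM : CMAbelianVarietyRealised) (Φ : CMType L) : (ofReflex ι₁ hCM Φ).A = realA hCM (reflexTypeInflate ι₁ Φ) := rfl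
/-- (Ported verbatim from the HodgeCMPerL package; no docstring in the source.) -/
@[simp] theorem ofReflex_τ (hCM : CMAbelianVarietyRealised) (Φ : CMType L) : (ofReflex ι₁ hCM Φ).τ = ι₁ := rfl
/-- (Ported verbatim from the HodgeCMPerL package; no docstring in the source.) -/
theorem ofReflex_ΦA (hCM : CMAbelianVarietyRealised) (Φ : CMType L) : (ofReflex ι₁ hCM Φ).ΦA = reflexTypeInflate ι₁ Φ := rfl

/-- **`d_Liu(Φ)` IS ADMISSIBLE**: it is the reflex side of `(L, Φ)` read through `ι₁`. [folklore] -/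
theorem ofReflex_isReflexOfType (hCM : CMAbelianVarietyRealised) (Φ : CMType L) : (ofReflex ι₁ hCM Φ).IsReflexOfType ι₁ Φ := by
  refine ⟨RingEquiv.refl _, RingHom.ext fun _ => rfl, fun ψ => ?_⟩
  refine Iff.of_eq (congrArg (fun χ => χ ∈ reflexTypeC ι₁ (autSet ι₁ Φ)) ?_)
  exact RingHom.ext fun _ => rfl

/-- (Ported verbatim from the HodgeCMPerL package; no docstring in the source.) -/
theorem ofReflex_isReflexOfTypeG (hCM : CMAbelianVarietyRealised) (Φ : CMType L) : (ofReflex ι₁ hCM Φ).IsReflexOfTypeG ι₁ Φ := fun _ => ofReflex_isReflexOfType ι₁ hCM Φ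

/-- its class `α` is non-zero. [folklore] -/
theorem ofReflex_α_ne_zero (hCM : CMAbelianVarietyRealised) (Φ : CMType L) : (ofReflex ι₁ hCM Φ).α ≠ 0 := (realBasis hCM (reflexTypeInflate ι₁ Φ)).ne_zero ι₁

/-- **Non-emptiness of the admissible class** ([Liu21 Prop. 4.6 (1)] at the model's typing): for `L/ℚ` Galois and every CM type `Φ`
of `L` there is a CM record admissible for `Φ` whose eigenclass `α` is non-zero. [folklore] -/
theorem exists_isReflexOfType_α_ne_zero (hCM : CMAbelianVarietyRealised) (Φ : CMType L) : ∃ d : LiuCMSide, d.IsReflexOfType ι₁ Φ ∧ d.α ≠ 0 :=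
  ⟨ofReflex ι₁ hCM Φ, ofReflex_isReflexOfType ι₁ hCM Φ, ofReflex_α_ne_zero ι₁ hCM Φ⟩

end OfReflex

/-- The Galois-guarded admissibility predicate of record is inhabited at every CM type, by a record with `α ≠ 0`. [folklore] -/
theorem exists_isReflexOfTypeG_α_ne_zero (hCM : CMAbelianVarietyRealised) (Φ : CMType L) :
    ∃ d : LiuCMSide, d.IsReflexOfTypeG ι₁ Φ ∧ d.α ≠ 0 := by
  by_cases hG : IsGalois ℚ L
  · exact ⟨ofReflex ι₁ hCM Φ, ofReflex_isReflexOfTypeG ι₁ hCM Φ, ofReflex_α_ne_zero ι₁ hCM Φ⟩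
  · exact ⟨ofType ι₁ hCM Φ, fun h => absurd h hG, ofType_α_ne_zero ι₁ hCM Φ⟩

end LiuCMSide

/-! ## §3 At the pinned dictionary: `adm` is inhabited at every index, so `cmClasses` ranges over genuine CM classes -/

section Pin

variable (hHD : exists_isReal_hodgeModel) (hI : hodgePQ_independent_of_hodgeModel)
  (h₁ : BallQuotientUniformised) (h₃ : CMAbelianVarietyRealised) (hA : Arapura2012_Cor_15_4_6)
variable {L : CMField} {ι₁ : L →+* ℂ} (V : HermSpace3 L ι₁) (I : Type) (line : I → SplitLineE V)

/-- **THE `adm` CONTRACT OF THE PINNED DICTIONARY IS INHABITED** at every index `j`, by a CM record with non-zero eigenclass, built from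
E's own `h₃` (Galois locus: `LiuCMSide.ofReflex` at `Φ := Φ^δ(line j)`; elsewhere the guard is vacuous). [folklore] -/
theorem exists_adm_liuDictionaryPin (j : I) :
    ∃ d : LiuCMSide, (liuDictionaryPin hHD hI h₁ h₃ hA V I line).adm j d ∧ d.α ≠ 0 :=
  LiuCMSide.exists_isReflexOfTypeG_α_ne_zero ι₁ h₃ (line j).lineType

/-- hence r8's generator set at `(Γ, j)` contains the classes `f^*α_d` of EVERY `ℂ`-morphism `f : P_Γ → A_d` into the abelian variety of an
admissible record with `α_d ≠ 0` (the comprehension is over a non-empty admissible class). [folklore] -/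
theorem exists_adm_forall_geomClass_mem (Γ : Level V) (j : I) :
    ∃ d : LiuCMSide, d.α ≠ 0 ∧ ∀ f : (pmsRealisation (ballQuotientUniformisedDatum_of h₁) (pmsCode L ι₁ V Γ)).X ⟶ d.A.X,
      LiuDictionary.geomClass (hHD := hHD) (hI := hI) (h₃ := h₃) Γ d f ∈
        (liuDictionaryPin hHD hI h₁ h₃ hA V I line).cmClasses Γ j := by
  obtain ⟨d, hd, hα⟩ := exists_adm_liuDictionaryPin hHD hI h₁ h₃ hA V I line j
  exact ⟨d, hα, fun f => LiuDictionary.geomClass_mem_cmClasses _ hd f⟩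

end Pin

end Model

end HodgeCM

end
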